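import Mathlib
import Summits.QuantumFields.YangMills.Theorems.ConvexGribovBodyContinuumLegGivenGapStubArp
import Summits.QuantumFields.YangMills.Theorems.ConvexGribovBodyContinuumLegGivenGapStubCltOfCscl
import Summits.QuantumFields.YangMills.Theorems.ConvexGribovBodyContinuumLegGivenGapStubAsympCS
import Summits.QuantumFields.YangMills.Theorems.ConvexGribovBodyContinuumLegGivenGapStubSmallRotation
import Summits.QuantumFields.YangMills.Theorems.ConvexGribovBodyContinuumLegGivenGapStubBddSlabDensity
import Summits.QuantumFields.YangMills.Theorems.ConvexGribovBodyContinuumLegGivenGapStubUclOfCscl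
import Summits.QuantumFields.YangMills.Theorems.ConvexGribovBodyContinuumLegGivenGapStubRotNiven
import Summits.QuantumFields.YangMills.Theorems.ConvexGribovBodyContinuumLegGivenGapStubRotHyper
import Summits.QuantumFields.YangMills.Theorems.ConvexGribovBodyContinuumLegGivenGapStubRotOfPythagorean
import Summits.QuantumFields.YangMills.Theorems.ConvexGribovBodyContinuumLegGivenGapStubCsclOfLock
import Summits.QuantumFields.YangMills.Theorems.ParabolicTrajectoryContinuumLimitOnTrajectoryStubTransl
import HarnessLib

/-!
# `ContinuumLegGivenGap` (stmt-QuantumFields-15828), line `Sketch`: split glue, part A — the UV package at the chosen representation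

Part A of the DEF-FREE Theorems rendering of the composition of line `Sketch` (reshape 18d,
`Cruxes/ContinuumLegGivenGap/Lines/Sketch.lean`, leads -0, c1–c7; decomposition artefact of the crux-strategist seat,
`Cruxes/ContinuumLegGivenGap/Lines/split-glue.md`): the registered open stub `stub_uvPackageVol` (the volume-uniform UV
engine: (UUVB) ∧ (ND) ∧ (ROT₃₄₅) at the gap-pinned unit, for every canonically normalised exactly centred admissible
scheme) is taken as an explicit HYPOTHESIS, written out verbatim, and turned into route ParabolicTrajectory's one-field
currency at the representation it chooses: for every locked IR datum with `m̂ → 0` there is a canonically normalised,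
exactly centred scheme `sch` at couplings `β ∘ φ`, spacings pinned by `Δ₀ a_k ≤ m̂(φ k)`, tori above the IR thresholds,
with `UUVB`, `ND2`, time-axis clustering (CL-t), `UCL`, `PolyVolumeGrowth`, `AsympTransl`, `AsympRot` and Cauchy–Schwarz
clustering of the canonical scheme — by the LANDED glue of the line: `stub_csclOfLock` (p142726; the scheme and (CSCL)),
`stub_rotOfPythagorean` ∘ (`stub_rotNiven`, `stub_rotHyper`) ((ROT) from (ROT₃₄₅)), `stub_cltOfCscl` ((CL-t)),
`stub_uclOfCscl` ∘ (`stub_asympCS`, `stub_smallRotation`, `stub_bddSlabDensity`) ((UCL)), route ParabolicTrajectory's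
`stub_transl` (translations). All functionals are route ParabolicTrajectory's `curvDistribution r sch` (which IS the
line's `LSk` under (CAN) ∧ (VS): `lsk_eq_curvDistribution`). No definitions, no facts, no `sorry`: a conditional
composition over landed theorems (it credits nothing by itself; the hypothesis is the open UV-engine child of the
strategist's split). [folklore]
-/

noncomputable section

namespace Summit.QuantumFields.YangMills.Theorems.ContinuumLegGivenGap

open scoped SchwartzMap
open Filter Topology MeasureTheory
open Literature.MathematicalPhysics.QuantumFieldTheory Literature.MathematicalPhysics.QuantumLattice
  Literature.MathematicalPhysics.AQFT Literature.Probability.LatticeModels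
open Summit.QuantumFields.YangMills.Cruxes.ContinuumLimitOnTrajectory.TwoOrbitSynchronisation
  (curvDistribution canon UUVB ND2 UCL PolyVolumeGrowth AsympTransl AsympRot)

variable {G : Type} [Group G] [TopologicalSpace G] [IsTopologicalGroup G] [CompactSpace G]
  [MeasurableSpace G] [BorelSpace G]

omit [Group G] [TopologicalSpace G] [IsTopologicalGroup G] [CompactSpace G] [MeasurableSpace G] [BorelSpace G] in
/-- Anchor (registered sub-goal of stmt-QuantumFields-15828 for this file): the couplings of a scheme built on locked data
along a strictly increasing reindexing run to infinity. [folklore] -/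
theorem cclgSplit_comp_tendsto : ∀ (β : ℕ → ℝ) (φ : ℕ → ℕ), Tendsto β atTop atTop → StrictMono φ → Tendsto (fun k => β (φ k)) atTop atTop :=
  fun _ _ hβ hφ => hβ.comp hφ.tendsto_atTop

/-- Under canonical normalisation and exact centring, route ParabolicTrajectory's `curvDistribution r sch` satisfies
the defining equation of the line's renormalised curvature functional (the form in which the registered stubs take
their functional `LS`). [folklore] -/
theorem cclgSplit_curv_eq (r : LatticeRep G) (sch : SpeciesScheme (YMSpecies G)) (hCAN : (∀ k : ℕ, sch.c r.curvature k = (sch.a k ^ 4)⁻¹)) (hVS : (∀ k : ℕ, sch.m r.curvature k =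
        ∫ U : GaugeConfig 4 (sch.side k) G, r.curvature.F (torusLift (sch.side k) U) ∂(wilsonMeasure r.ρ (sch.β k)))) :
    (∀ (k n : ℕ) (F : SchwartzMap (Fin n → EuclideanSpace ℝ (Fin 4)) ℂ), curvDistribution r sch k n F =
        ∫ U : GaugeConfig 4 (sch.side k) G, ∑ x : Fin n → ↥(box 4 (sch.L k)),
          F (fun i => sch.a k • siteToE ↑(x i)) *
            ∏ i, ((sch.c r.curvature k * sch.a k ^ 4 *
              (r.curvature.F (configShift (-↑(x i)) (torusLift (sch.side k) U)) - sch.m r.curvature k) : ℝ) : ℂ)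
          ∂(wilsonMeasure r.ρ (sch.β k))) := by
  intro k n F
  exact (lsk_eq_curvDistribution r sch
    (fun (k n : ℕ) (F : SchwartzMap (Fin n → EuclideanSpace ℝ (Fin 4)) ℂ) =>
          ∫ U : GaugeConfig 4 (sch.side k) G, ∑ x : Fin n → ↥(box 4 (sch.L k)),
            F (fun i => sch.a k • siteToE ↑(x i)) *
              ∏ i, ((sch.c r.curvature k * sch.a k ^ 4 *
                (r.curvature.F (configShift (-↑(x i)) (torusLift (sch.side k) U)) - sch.m r.curvature k) : ℝ) : ℂ)
            ∂(wilsonMeasure r.ρ (sch.β k)))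
    (fun _ _ _ => rfl) hCAN hVS k n F).symm

/-- **The UV package at the chosen representation, from the UV-engine hypothesis** (`uvPackage_exists` of line
`Sketch`, def-free): the hypothesis is the registered `stub_uvPackageVol` verbatim. [folklore] -/
theorem cclgSplit_uvPackage_exists
    (hUV : (∀ (G : Type) [Group G] [TopologicalSpace G] [IsTopologicalGroup G] [CompactSpace G]
      [MeasurableSpace G] [BorelSpace G], IsCompactSimpleLieGroup G → ∃ r : LatticeRep G,
      ∀ (β : ℕ → ℝ) (mh : ℕ → ℝ) (S₁ : ℕ → ℕ) (K : ℝ), Tendsto β atTop atTop → (∀ k, 0 < mh k) → 0 < K →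
      (∀ A B : YMSpecies G, ∃ C : ℝ, ∀ k S n : ℕ, S₁ k ≤ S → n ≤ S →
        |latticeConnectedCorr r.ρ (β k) (2 * S + 1) A.F B.F n| ≤ C * Real.exp (-(mh k * n))) →
      (∀ k S₀ : ℕ, ∃ A B : YMSpecies G, ∀ C : ℝ, ∃ S n : ℕ, S₀ ≤ S ∧ n ≤ S ∧
        C * Real.exp (-(K * mh k * n)) < |latticeConnectedCorr r.ρ (β k) (2 * S + 1) A.F B.F n|) →
      Tendsto mh atTop (𝓝 0) →
      ∃ (a : ℕ → ℝ) (φ : ℕ → ℕ) (Δ₀ : ℝ) (𝓛 : ℕ → Set ℕ),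
        (∀ k, 0 < a k) ∧ StrictMono φ ∧ 0 < Δ₀ ∧ (∀ k, Δ₀ * a k ≤ mh (φ k)) ∧
        (∀ k S : ℕ, ∃ S' : ℕ, S' ∈ 𝓛 k ∧ S ≤ S') ∧ (∀ k : ℕ, ∀ S ∈ 𝓛 k, S₁ (φ k) ≤ S) ∧
        (∃ N : ℕ, 1 ≤ N ∧ ∀ᶠ k in atTop, ∀ S ∈ 𝓛 k, (a k)⁻¹ ≤ (a k * (S : ℝ)) ^ N) ∧
      ∀ (sch : SpeciesScheme (YMSpecies G)), (∀ k, sch.a k = a k) → (∀ k, sch.β k = β (φ k)) →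
        (∀ k, sch.L k ∈ 𝓛 k) →
      ∀ (LS : (k n : ℕ) → SchwartzMap (Fin n → EuclideanSpace ℝ (Fin 4)) ℂ → ℂ),
      (∀ (k n : ℕ) (F : SchwartzMap (Fin n → EuclideanSpace ℝ (Fin 4)) ℂ), LS k n F =
        ∫ U : GaugeConfig 4 (sch.side k) G, ∑ x : Fin n → ↥(Literature.Probability.LatticeModels.box 4 (sch.L k)),
          F (fun i => sch.a k • siteToE ↑(x i)) *
            ∏ i, ((sch.c r.curvature k * sch.a k ^ 4 *
              (r.curvature.F (Literature.MathematicalPhysics.QuantumLattice.configShift (-↑(x i)) (Literature.MathematicalPhysics.QuantumLattice.torusLift (sch.side k) U)) - sch.m r.curvature k) : ℝ) : ℂ)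
          ∂(wilsonMeasure r.ρ (sch.β k))) →
      (∀ k : ℕ, sch.m r.curvature k =
        ∫ U : GaugeConfig 4 (sch.side k) G, r.curvature.F (Literature.MathematicalPhysics.QuantumLattice.torusLift (sch.side k) U) ∂(wilsonMeasure r.ρ (sch.β k))) →
      (∀ k : ℕ, sch.c r.curvature k = (sch.a k ^ 4)⁻¹) →
      (∃ (s : ℕ) (α β' : ℝ), ∀ᶠ k in atTop, ∀ (p : ℕ) (q : Fin p → {q : Fin 4 × Fin 4 // q.1 < q.2})
        (F : SchwartzMap (Fin p → EuclideanSpace ℝ (Fin 4)) ℂ), IsOffDiagonal F →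
        ‖∫ U : GaugeConfig 4 (sch.side k) G, ∑ x : Fin p → ↥(Literature.Probability.LatticeModels.box 4 (sch.L k)),
            F (fun i => sch.a k • siteToE ↑(x i)) *
              ∏ i, ((plaquetteObs r.ρ 0 (q i).1.1 (q i).1.2 (Literature.MathematicalPhysics.QuantumLattice.configShift (-↑(x i)) (Literature.MathematicalPhysics.QuantumLattice.torusLift (sch.side k) U)) -
                wilsonTorusMean r.ρ (sch.β k) (sch.L k) (plaquetteObs r.ρ 0 (q i).1.1 (q i).1.2) : ℝ) : ℂ)
            ∂(wilsonMeasure r.ρ (sch.β k))‖ ≤ α * (p.factorial : ℝ) ^ β' * schwartzNorm (p * s) F) ∧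
      (∃ (f g : SchwartzMap (Fin 1 → EuclideanSpace ℝ (Fin 4)) ℂ)
        (H : SchwartzMap (Fin (1 + 1) → EuclideanSpace ℝ (Fin 4)) ℂ),
        IsTimeOrdered f ∧ IsTimeOrdered g ∧ IsAppendTensorOf H (osAdjoint f) g ∧
          ∃ δ : ℝ, 0 < δ ∧ ∀ᶠ k in atTop, δ ≤ ‖LS k (1 + 1) H‖) ∧
      (∀ R : EuclideanSpace ℝ (Fin 4) ≃ₗᵢ[ℝ] EuclideanSpace ℝ (Fin 4),
        R (EuclideanSpace.single 0 1) =
          (3 / 5 : ℝ) • EuclideanSpace.single 0 1 + (-(4 / 5) : ℝ) • EuclideanSpace.single 1 1 →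
        R (EuclideanSpace.single 1 1) =
          (4 / 5 : ℝ) • EuclideanSpace.single 0 1 + (3 / 5 : ℝ) • EuclideanSpace.single 1 1 →
        R (EuclideanSpace.single 2 1) = EuclideanSpace.single 2 1 →
        R (EuclideanSpace.single 3 1) = EuclideanSpace.single 3 1 →
        ∀ (n : ℕ) (F : SchwartzMap (Fin n → EuclideanSpace ℝ (Fin 4)) ℂ), IsOffDiagonal F →
          Tendsto (fun k : ℕ => LS k n (linActMulti R F) - LS k n F) atTop (𝓝 0))))
    (hG : IsCompactSimpleLieGroup G) :
    ∃ r : LatticeRep G, ∀ (β : ℕ → ℝ) (mh : ℕ → ℝ) (S₁ : ℕ → ℕ) (K : ℝ),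
      (Tendsto β atTop atTop ∧ (∀ k, 0 < mh k) ∧ 0 < K ∧
        (∀ A B : YMSpecies G, ∃ C : ℝ, ∀ k S n : ℕ, S₁ k ≤ S → n ≤ S →
          |latticeConnectedCorr r.ρ (β k) (2 * S + 1) A.F B.F n| ≤ C * Real.exp (-(mh k * n))) ∧
        (∀ k S₀ : ℕ, ∃ A B : YMSpecies G, ∀ C : ℝ, ∃ S n : ℕ, S₀ ≤ S ∧ n ≤ S ∧
          C * Real.exp (-(K * mh k * n)) < |latticeConnectedCorr r.ρ (β k) (2 * S + 1) A.F B.F n|)) →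
      Tendsto mh atTop (𝓝 0) →
        ∃ (sch : SpeciesScheme (YMSpecies G)) (φ : ℕ → ℕ) (Δ₀ : ℝ), StrictMono φ ∧
          (∀ k, sch.β k = β (φ k)) ∧ 0 < Δ₀ ∧ (∀ k, Δ₀ * sch.a k ≤ mh (φ k)) ∧ (∀ k, S₁ (φ k) ≤ sch.L k) ∧
          (∀ k : ℕ, sch.m r.curvature k =
        ∫ U : GaugeConfig 4 (sch.side k) G, r.curvature.F (torusLift (sch.side k) U) ∂(wilsonMeasure r.ρ (sch.β k))) ∧
          (∀ k : ℕ, sch.c r.curvature k = (sch.a k ^ 4)⁻¹) ∧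
          UUVB r sch ∧ ND2 r sch ∧
          (∃ Δ : ℝ, 0 < Δ ∧ ∀ (n m : ℕ) (F : SchwartzMap (Fin n → EuclideanSpace ℝ (Fin 4)) ℂ)
        (G' : SchwartzMap (Fin m → EuclideanSpace ℝ (Fin 4)) ℂ), IsTimeOrdered F → IsTimeOrdered G' →
        ∃ C : ℝ, ∀ t : ℝ, 0 ≤ t → ∀ᶠ k in atTop,
          ∀ H : SchwartzMap (Fin (n + m) → EuclideanSpace ℝ (Fin 4)) ℂ,
            IsAppendTensorOf H (osAdjoint F) (translateMulti (EuclideanSpace.single 0 t) G') →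
              ‖curvDistribution r sch k (n + m) H - curvDistribution r sch k n (osAdjoint F) *
                curvDistribution r sch k m G'‖ ≤ C * Real.exp (-Δ * t)) ∧
          UCL r sch ∧ PolyVolumeGrowth sch ∧ AsympTransl r sch ∧ AsympRot r sch ∧
          (∃ Δ₁ : ℝ, 0 < Δ₁ ∧ SpeciesScheme.HasCSClustering r (canon r sch) Δ₁) := by
  obtain ⟨r, hr⟩ := hUV G hG
  refine ⟨r, fun β mh S₁ K hL hcrit => ?_⟩
  obtain ⟨hβinf, hmh, hK, hunif, hsharp⟩ := hL
  obtain ⟨a, φ, Δ₀, 𝓛, ha0, hφ, hΔ₀, ha, hcof, hthr, hpvg, hper⟩ := hr β mh S₁ K hβinf hmh hK hunif hsharp hcrit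
  -- the scheme (its torus chosen in `𝓛`) and (CSCL): the landed assembly `stub_csclOfLock`
  obtain ⟨sch, hsa, hβ, hsL, hCAN, hVS, hCS⟩ :=
    stub_csclOfLock G r β mh S₁ a φ Δ₀ 𝓛 hβinf hmh hunif ha0 hφ hΔ₀ ha hcrit hcof hthr hpvg
      (fun sch' h1 h2 h3 hVS' hCAN' => (hper sch' h1 h2 h3
        (fun (k n : ℕ) (F : SchwartzMap (Fin n → EuclideanSpace ℝ (Fin 4)) ℂ) =>
          ∫ U : GaugeConfig 4 (sch'.side k) G, ∑ x : Fin n → ↥(box 4 (sch'.L k)),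
            F (fun i => sch'.a k • siteToE ↑(x i)) *
              ∏ i, ((sch'.c r.curvature k * sch'.a k ^ 4 *
                (r.curvature.F (configShift (-↑(x i)) (torusLift (sch'.side k) U)) - sch'.m r.curvature k) : ℝ) : ℂ)
            ∂(wilsonMeasure r.ρ (sch'.β k)))
        (fun _ _ _ => rfl) hVS' hCAN').1)
  have hEQ : (∀ (k n : ℕ) (F : SchwartzMap (Fin n → EuclideanSpace ℝ (Fin 4)) ℂ), curvDistribution r sch k n F =
        ∫ U : GaugeConfig 4 (sch.side k) G, ∑ x : Fin n → ↥(box 4 (sch.L k)),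
          F (fun i => sch.a k • siteToE ↑(x i)) *
            ∏ i, ((sch.c r.curvature k * sch.a k ^ 4 *
              (r.curvature.F (configShift (-↑(x i)) (torusLift (sch.side k) U)) - sch.m r.curvature k) : ℝ) : ℂ)
          ∂(wilsonMeasure r.ρ (sch.β k))) := cclgSplit_curv_eq r sch hCAN hVS
  obtain ⟨hUUVB, hND, hROT345⟩ := hper sch hsa hβ hsL (curvDistribution r sch) hEQ hVS hCAN
  have hUU : UUVB r sch := uuvb_of_unfolded r sch hUUVB
  have ha' : ∀ k, Δ₀ * sch.a k ≤ mh (φ k) := fun k => by rw [hsa k]; exact ha k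
  have hLk : ∀ k, S₁ (φ k) ≤ sch.L k := fun k => hthr k _ (hsL k)
  have hPVG : PolyVolumeGrowth sch := by
    obtain ⟨N, hN, hev⟩ := hpvg
    refine ⟨N, hN, hev.mono fun k hk => ?_⟩
    have h := hk (sch.L k) (hsL k)
    rwa [← hsa k] at h
  -- (ROT) from (ROT₃₄₅) ∧ (UUVB): `stub_rotOfPythagorean` ∘ (`stub_rotNiven`, `stub_rotHyper`)
  have hROT : AsympRot r sch := fun n F hF R hR =>
    stub_rotOfPythagorean G r sch stub_rotNiven stub_rotHyper hUU hROT345 n F hF R hR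
  -- (CL-t) from (CAN) ∧ (VS) ∧ (UUVB) ∧ (PVG) ∧ (CSCL): `stub_cltOfCscl`
  have hCLt : (∃ Δ : ℝ, 0 < Δ ∧ ∀ (n m : ℕ) (F : SchwartzMap (Fin n → EuclideanSpace ℝ (Fin 4)) ℂ)
        (G' : SchwartzMap (Fin m → EuclideanSpace ℝ (Fin 4)) ℂ), IsTimeOrdered F → IsTimeOrdered G' →
        ∃ C : ℝ, ∀ t : ℝ, 0 ≤ t → ∀ᶠ k in atTop,
          ∀ H : SchwartzMap (Fin (n + m) → EuclideanSpace ℝ (Fin 4)) ℂ,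
            IsAppendTensorOf H (osAdjoint F) (translateMulti (EuclideanSpace.single 0 t) G') →
              ‖curvDistribution r sch k (n + m) H - curvDistribution r sch k n (osAdjoint F) *
                curvDistribution r sch k m G'‖ ≤ C * Real.exp (-Δ * t)) :=
    stub_cltOfCscl G r sch (curvDistribution r sch) hEQ hCAN hVS hUUVB hPVG hCS
  have hAF : Tendsto sch.β atTop atTop := by
    rw [show sch.β = fun k => β (φ k) from funext hβ]
    exact cclgSplit_comp_tendsto β φ hβinf hφ
  -- (UCL) from (CSCL) ∧ (ROT) ∧ (UUVB) ∧ (PVG) ∧ AF: `stub_uclOfCscl` ∘ (`stub_asympCS`, `stub_smallRotation`, `stub_bddSlabDensity`)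
  have hUCL : UCL r sch :=
    stub_uclOfCscl G r sch stub_asympCS stub_smallRotation stub_bddSlabDensity hAF hUU hPVG hROT hCS
  -- translations from (PVG) ∧ (UUVB): route ParabolicTrajectory's `stub_transl`
  have hEUC : AsympTransl r sch := fun n F hF v =>
    Summit.QuantumFields.YangMills.Cruxes.ContinuumLimitOnTrajectory.TwoOrbitSynchronisation.stub_transl G r sch
      hPVG hUU n F hF v
  exact ⟨sch, φ, Δ₀, hφ, hβ, hΔ₀, ha', hLk, hVS, hCAN, hUU, hND, hCLt, hUCL, hPVG, hEUC, hROT, hCS⟩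

end Summit.QuantumFields.YangMills.Theorems.ContinuumLegGivenGap

end
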